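import Mathlib
import Summits.KontsevichZagierPeriods.Zeta5Search.ClusterValuationPairs
import HarnessLib

/-!
# ζ(5) search — CELL ATLAS of the missing denominator law on the record ray (census g11 statement file; filed verbatim by P1 g5 for the lead lane)
HONEST FRAMING: systematic search; no irrationality claim unless certified.

For Brown–Zudilin's record direction `a = (8,16,10,15,12,16,18,13)`, dual ray `b(n) = bRec n = n·(41;17,16,15,14,13,12,11)`,
`j = 7` (the least parameter `11n`), the constant term of the cellular linear form is `P_n = ρ(b)·Cas₇(b)` with
`Cas₇ = casoratian (bRec n) 7 = W(b+e₇)V(b) − W(b)V(b+e₇)`.  Census g11 (`code/census/g11/atlas.py`) lists the maximal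
intervals of `p/n` on which the PROVED bound (tree laws T ∪ gen-2's paper-proved class bounds K ∪ THEOREM LB) and
Brown–Zudilin's CONJECTURAL accounting (28)–(30) for `v_p(P_n)` are constant and differ.  The statements below are the
three heaviest cells with `p > 4n`, as OBSERVED regularities (exact gen-1 arithmetic, every instance `n ≤ 16`), typed over
tree objects only.  Each is worth the stated amount of the 9.224 nats/step separating the proved column (58.830) from C₂ = 49.606.
-/

namespace Summit.KontsevichZagierPeriods.Zeta5Search.CellAtlas

open Summit.KontsevichZagierPeriods.Zeta5Search.CasoratianValuation (casoratian)
open Summit.KontsevichZagierPeriods.Zeta5Search.ClusterValuation (bRec)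

/-- **CELL A (census g11, OBSERVED 26/26 instances n ≤ 16; weight 1.000 nats/step).**  For primes `14n < p < 15n`
(`ord_p ρ(b) = 3` there, proved bound `v_p(Cas₇) ≥ −5`, i.e. `v_p(P_n) ≥ −2`): `v_p(Cas₇(b(n))) ≥ −4` (`v_p(P_n) ≥ −1`),
with equality at every instance.  Equivalent digit form: `W(b+e₇)/W(b) ≡ V(b+e₇)/V(b) (mod p)` after removing `p`-powers. -/
@[conjecture] def RecordCellA : Prop :=
  ∀ n p : ℕ, 2 ≤ n → p.Prime → 14 * n < p → p < 15 * n → casoratian (bRec n) 7 ≠ 0 →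
    (-4 : ℤ) ≤ padicValRat p (casoratian (bRec n) 7)

/-- **CELL D (census g11, OBSERVED 15/15, n ≤ 16; weight 0.500).**  For primes `7n < p < 7.5n` (`ord_p ρ = 11`, proved `v_p(Cas₇) ≥ −13`):
`v_p(Cas₇(b(n))) ≥ −12` (`v_p(P_n) ≥ −1`, proved `−2`). -/
@[conjecture] def RecordCellD : Prop :=
  ∀ n p : ℕ, 2 ≤ n → p.Prime → 14 * n < 2 * p → 2 * p < 15 * n → casoratian (bRec n) 7 ≠ 0 →
    (-12 : ℤ) ≤ padicValRat p (casoratian (bRec n) 7)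

/-- **CELL B (census g11, OBSERVED 13/13, n ≤ 16; weight 0.500).**  For primes `12n < p < 12.5n` (`ord_p ρ = 2`, proved `v_p(Cas₇) ≥ −7`):
`v_p(Cas₇(b(n))) ≥ −6` (`v_p(P_n) ≥ −4`, proved `−5`). -/
@[conjecture] def RecordCellB : Prop :=
  ∀ n p : ℕ, 2 ≤ n → p.Prime → 12 * n < p → 2 * p < 25 * n → casoratian (bRec n) 7 ≠ 0 →
    (-6 : ℤ) ≤ padicValRat p (casoratian (bRec n) 7)

/-! ## The one-parameter CONSECUTIVE FAMILY through the record (census g11 §15.8)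
`bFam t n = n·(3t+8; t+6, t+5, t+4, t+3, t+2, t+1, t)` is the dual ray of the direction `a_rec + (t − 11)·(1,…,1)`
(`bFam 11 = bRec`; `t = 12, 14` are NEAR-MISSES rows 2, 3; `d = (2t+3)n`, least parameter index `j = 7`).  The three record
cells are instances of laws UNIFORM in `t` (exact check `code/census/g11/famtest_all.py` + atlases: cell A 103 instances over t = 4..20, cell B
43 over t = 5..20, cell D 39 over t = 10..20, zero exceptions; at every cell-A instance `v_p(W) = −1`, `v_p(V) = −4` at both
corners up to a common shift, `ord_p ρ = 3`, and T∪K∪LB prove only `−5`). -/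

/-- The consecutive family `n·(3t+8; t+6,…,t)`. -/
def bFam (t n : ℕ) : ℕ → ℤ :=
  fun i => (n : ℤ) * (([3 * (t : ℤ) + 8, t + 6, t + 5, t + 4, t + 3, t + 2, t + 1, t] : List ℤ).getD i 0)

/-- `t = 11` is the record ray. -/
theorem bFam_eleven (n : ℕ) : bFam 11 n = bRec n := by
  funext i
  simp only [bFam, bRec]
  norm_num

/-- **FAMILY CELL A (census g11, OBSERVED 103/103; t = 11 is `RecordCellA`).**  For `t ≥ 4`, `n ≥ 2` and primes
`(t+3)n < p < (t+4)n`: `v_p(Cas₇(bFam t n)) ≥ −4` (equality observed; proved bound −5 for t ≥ 5). -/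
@[conjecture] def FamilyCellA : Prop :=
  ∀ t n p : ℕ, 4 ≤ t → 2 ≤ n → p.Prime → (t + 3) * n < p → p < (t + 4) * n → casoratian (bFam t n) 7 ≠ 0 →
    (-4 : ℤ) ≤ padicValRat p (casoratian (bFam t n) 7)

/-- **FAMILY CELL B (census g11, OBSERVED 43/43, t = 5..20; t = 11 is `RecordCellB`).**  For `t ≥ 5`, `n ≥ 2` and primes
`(t+1)n < p < (t+3/2)n` (`ord_p ρ = 2`): `v_p(Cas₇(bFam t n)) ≥ −6` (proved −7). -/
@[conjecture] def FamilyCellB : Prop :=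
  ∀ t n p : ℕ, 5 ≤ t → 2 ≤ n → p.Prime → (t + 1) * n < p → 2 * p < (2 * t + 3) * n → casoratian (bFam t n) 7 ≠ 0 →
    (-6 : ℤ) ≤ padicValRat p (casoratian (bFam t n) 7)

/-- **FAMILY CELL D (census g11, OBSERVED 39/39, t = 10..20; t = 11 is `RecordCellD`; for t ≤ 9 other `h`-lines cross the
cell and `ord_p ρ` drops below 11).**  For `t ≥ 10`, `n ≥ 2` and primes `(t+3)n < 2p < (t+4)n` (`ord_p ρ = 11`):
`v_p(Cas₇(bFam t n)) ≥ −12` (proved −13). -/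
@[conjecture] def FamilyCellD : Prop :=
  ∀ t n p : ℕ, 10 ≤ t → 2 ≤ n → p.Prime → (t + 3) * n < 2 * p → 2 * p < (t + 4) * n → casoratian (bFam t n) 7 ≠ 0 →
    (-12 : ℤ) ≤ padicValRat p (casoratian (bFam t n) 7)

/-- Cell A of the record is the instance `t = 11` of the family cell A. -/
theorem recordCellA_of_family (h : FamilyCellA) : RecordCellA := by
  intro n p hn hp h1 h2 hne
  have := h 11 n p (by norm_num) hn hp (by omega) (by omega) (by rwa [bFam_eleven])
  rwa [bFam_eleven] at this

/-- Cell B of the record is the instance `t = 11` of the family cell B. -/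
theorem recordCellB_of_family (h : FamilyCellB) : RecordCellB := by
  intro n p hn hp h1 h2 hne
  have := h 11 n p (by norm_num) hn hp (by omega) (by omega) (by rwa [bFam_eleven])
  rwa [bFam_eleven] at this

/-- Cell D of the record is the instance `t = 11` of the family cell D. -/
theorem recordCellD_of_family (h : FamilyCellD) : RecordCellD := by
  intro n p hn hp h1 h2 hne
  have := h 11 n p (by norm_num) hn hp (by omega) (by omega) (by rwa [bFam_eleven])
  rwa [bFam_eleven] at this

end Summit.KontsevichZagierPeriods.Zeta5Search.CellAtlas
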